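import Mathlib
import HarnessLib
import Summits.RiemannHypothesis.RiemannHypothesis.Theses.LeeYang
import Literature.Probability.LatticeModels.IsingLimitLaw
import Literature.Probability.LatticeModels.IsingLimitLawLaplace
import Literature.Analysis.Complex.PolyaBesselKernel
import Summits.RiemannHypothesis.RiemannHypothesis.Theorems.LeeYangLeeyangPolyaKernelIsingLimitDefs
import Summits.RiemannHypothesis.RiemannHypothesis.Theorems.LeeYangLeeyangPolyaKernelIsingLimitStubTransfer
import Summits.RiemannHypothesis.RiemannHypothesis.Theorems.LeeYangLeeyangPolyaKernelIsingLimitStubCoshTilt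
import Summits.RiemannHypothesis.RiemannHypothesis.Theorems.LeeYangLeeyangPolyaKernelIsingLimitStubRate
import Summits.RiemannHypothesis.RiemannHypothesis.Theorems.LeeYangLeeyangPolyaKernelIsingLimitStubEuler
import Summits.RiemannHypothesis.RiemannHypothesis.Theorems.LeeYangLeeyangPolyaKernelIsingLimitStubCone
import Summits.RiemannHypothesis.RiemannHypothesis.Theorems.LeeYangLeeyangPolyaKernelIsingLimitStubLocalError
import Summits.RiemannHypothesis.RiemannHypothesis.Theorems.LeeYangLeeyangPolyaKernelIsingLimitStubSolution
import Summits.RiemannHypothesis.RiemannHypothesis.Theorems.LeeYangLeeyangPolyaKernelIsingLimitStubMoments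

/-!
# Crux `LeeYang.LeeyangPolyaKernelIsingLimit` (stmt-RiemannHypothesis-0453): Pólya's kernel law is an Ising limit law

Closing file of the line `telegraph-bessel-chain` (skeleton `Cruxes/LeeyangPolyaKernelIsingLimit/Lines/Sketch.lean`,
lead `prover-line-stmt-RiemannHypothesis-0453-0`, 2026-08-16; idea cards `Ideas/telegraph-bessel-chain.md`,
`Ideas/bessel-telegraph-chain.md`, `Ideas/ghost-spin-universal-factor.md` — one mechanism).

**Theorem** (`Summit.RiemannHypothesis.RiemannHypothesis.Theorems.leeyangPolyaKernelIsingLimit_proof`, the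
route decl BY NAME). The probability law `∝ cosh(9u/2) e^{−2π cosh 2u} du` on `ℝ` — the symmetrised leading
term of Riemann's `Φ`, Pólya 1926 — is an Ising limit law (`Literature.Probability.LatticeModels.IsIsingLimitLaw`):
a weak limit, with `∫e^{bu²}` bounded along the sequence for every `b`, of magnetization laws of finite
FERROMAGNETIC spin-½ systems with non-negative weights. By Newman's closure theorem (tree:
`hasLeeYangProperty_of_isIsingLimitLaw_holds`) this re-proves, statistical-mechanically, Pólya's theorem that
the "fake" `Ξ*` has only real zeros; it is the calibration crux #2 of route RiemannHypothesis/LeeYang.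

## The construction (all objects in `…Theorems.LeeYangLeeyangPolyaKernelIsingLimitDefs`)

`t = log(s/a)`, `v = a e^t`. The telegraph process with flip rate `r_a(t) = v K₁(v)/K₀(v)` (Doob transform of
`h″ = v²h` by `K₀(ae^t)`) has `E e^{z∫₀^∞σ dt} = K_z(a)/K₀(a)`: the backward system `S′ = −zD`,
`D′ = −zS + 2rD` is solved by `S = 2K_z(ae^t)/K₀(ae^t) = solS`, `D = solD` (`stub_solution`, with the Bessel
input `stub_rate`: `G₀(v,0) > 0`, `q = K₁/K₀ ≥ 1` antitone, `r′ = r² − v²`). The open nearest-neighbour Ising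
chain `k` (`nBonds k = (k+2)^5` bonds, horizon `log(k+2)`, uniform weights `mesh k/κ`, bond parameters
`tanh K_m = bondTanh a k m = e^{−2η r(t_{m+1})} ∈ (0,1)`, so `K_m ≥ 0`) has Laplace transform given EXACTLY
by the `2 × 2` transfer recursion `sdIter` (`stub_transfer`) — the Euler scheme of that system, second-order
consistent (`stub_localError`) and a product of contractions at `z = iy`, hence convergent (`stub_euler`); with
`charFun_kernelMeasure` and Lévy's continuity theorem this gives weak convergence to the law
`∝ e^{−a cosh κu}du`. A cone invariant of the same recursion at real `z = h` (`stub_cone`) bounds the Laplace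
transforms by `exp(2√2 (h/κ)^{3/2}/√a + o(1)h²)`, and Hubbard–Stratonovich turns this into uniform
Gaussian-exponential moments (`stub_moments`). Hence `polyaKernelIsingLimit`: the law `∝ e^{−a cosh κu}du` is
an Ising limit law for all `a, κ > 0`. Finally `cosh(9u/2)` is one ghost spin of weight `0`
(`stub_coshTilt`: the class is closed under `cosh(cu)`-tilts), and the crux law is the `cosh((9/2)u)`-tilt of
the case `a = 2π`, `κ = 2` (`LeeyangPolyaKernelIsingLimit_of`, measure algebra).

All eight stubs are landed theorems of `Summits/RiemannHypothesis/RiemannHypothesis/Theorems/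
LeeYangLeeyangPolyaKernelIsingLimitStub*.lean`; this file contains the glue and the composition, sorry-free.
No literature fact is assumed: the inputs are Mathlib, the tree's fully proved `PolyaBesselKernel.lean`
(Bessel's equation for `G_n = ∫cosh^n e^{−v cosh t}e^{iwt}dt`) and `IsingLimitLaw*.lean`.
Disproof used: none existed for this crux (no `Disproof.lean`, empty negatives index, 2026-08-16).
References: G. Pólya, Acta Math. 48 (1926) 305–317; M. Kac, Rocky Mountain J. Math. 4 (1974) 497–509;
R. B. Griffiths, J. Math. Phys. 8 (1967) 478; C. M. Newman, CPAM 27 (1974) 143–159.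
-/

noncomputable section

namespace Summit.RiemannHypothesis.RiemannHypothesis.Theorems.LeeYangTelegraph

open MeasureTheory Filter Topology Complex
open Literature.Probability.LatticeModels Literature.Analysis.Complex.Polya1926

/-! ## Glue: elementary facts about the objects -/

/-- `tanh(artanh c) = c` for `0 ≤ c < 1`. [folklore] -/
theorem tanh_couplingOfTanh {c : ℝ} (h0 : 0 ≤ c) (h1 : c < 1) :
    Real.tanh (couplingOfTanh c) = c := by
  have h1c : 0 < 1 - c := by linarith
  have hq : 0 < (1 + c) / (1 - c) := div_pos (by linarith) h1c
  have h2x : Real.exp (2 * couplingOfTanh c) = (1 + c) / (1 - c) := by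
    rw [couplingOfTanh, show 2 * (Real.log ((1 + c) / (1 - c)) / 2) =
      Real.log ((1 + c) / (1 - c)) by ring, Real.exp_log hq]
  rw [Real.tanh_eq]
  have hx : Real.exp (couplingOfTanh c) ≠ 0 := (Real.exp_pos _).ne'
  have key : (Real.exp (couplingOfTanh c) - Real.exp (-couplingOfTanh c)) /
      (Real.exp (couplingOfTanh c) + Real.exp (-couplingOfTanh c)) =
      (Real.exp (2 * couplingOfTanh c) - 1) / (Real.exp (2 * couplingOfTanh c) + 1) := by
    rw [Real.exp_neg, two_mul, Real.exp_add]
    field_simp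
  rw [key, h2x]
  field_simp
  ring

/-- `artanh c ≥ 0` for `c ∈ [0, 1]` (with the junk value `artanh 1 = 0`). [folklore] -/
theorem couplingOfTanh_nonneg {c : ℝ} (h0 : 0 ≤ c) (h1 : c ≤ 1) : 0 ≤ couplingOfTanh c := by
  unfold couplingOfTanh
  rcases h1.lt_or_eq with h1 | h1
  · refine div_nonneg (Real.log_nonneg ?_) two_pos.le
    rw [le_div_iff₀ (by linarith)]
    linarith
  · subst h1; simp

/-- Chains with non-negative bond couplings are ferromagnetic. [folklore] -/
theorem chainJ_nonneg {N : ℕ} {K : ℕ → ℝ} (hK : ∀ m, 0 ≤ K m) (i j : Fin N) :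
    0 ≤ chainJ N K i j := by
  unfold chainJ
  split_ifs
  · exact div_nonneg (hK _) two_pos.le
  · exact div_nonneg (hK _) two_pos.le
  · exact le_rfl

/-- The transfer recursion only depends on the products `z · w m`. [folklore] -/
theorem sdIter_congr {z z' : ℂ} {w w' : ℕ → ℝ} (c : ℕ → ℝ)
    (h : ∀ m, z * w m = z' * w' m) (m : ℕ) : sdIter z w c m = sdIter z' w' c m := by
  induction m with
  | zero => simp only [sdIter, h 0]
  | succ m ih => simp only [sdIter, ih, h (m + 1)]

/-! ## Glue: the kernel law -/

section Kernel

variable {a κ : ℝ}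

/-- The density `u ↦ e^{−a cosh(κu)}` is continuous. [folklore] -/
theorem continuous_kernel (a κ : ℝ) : Continuous fun u : ℝ => polyaKernel 0 a (κ * u) :=
  (continuous_polyaKernel 0 a).comp (continuous_const.mul continuous_id)

/-- The density is integrable (`a > 0`, `κ ≠ 0`). [folklore] -/
theorem integrable_kernel (ha : 0 < a) (hκ : 0 < κ) :
    Integrable fun u : ℝ => polyaKernel 0 a (κ * u) := by
  have h1 : Integrable fun t : ℝ => polyaKernel 0 a t := by
    simpa using (integrable_polyaKernel_zero ha).re
  exact h1.comp_mul_left' hκ.ne'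

/-- `∫ e^{−a cosh(κu)} du ∈ (0, ∞)` as an extended real: not `⊤`. [folklore] -/
theorem lintegral_kernel_ne_top (ha : 0 < a) (hκ : 0 < κ) :
    (∫⁻ u, ENNReal.ofReal (polyaKernel 0 a (κ * u))) ≠ ⊤ :=
  (integrable_kernel ha hκ).lintegral_lt_top.ne

/-- `∫ e^{−a cosh(κu)} du ≠ 0`. [folklore] -/
theorem lintegral_kernel_ne_zero (a κ : ℝ) :
    (∫⁻ u, ENNReal.ofReal (polyaKernel 0 a (κ * u))) ≠ 0 := by
  refine ((lintegral_pos_iff_support (continuous_kernel a κ).measurable.ennreal_ofReal).2 ?_).ne'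
  have : Function.support (fun u : ℝ => ENNReal.ofReal (polyaKernel 0 a (κ * u))) = Set.univ := by
    refine Set.eq_univ_of_forall fun u => ?_
    simp only [Function.mem_support, ne_eq, ENNReal.ofReal_eq_zero, not_le]
    exact polyaKernel_pos 0 a _
  simp [this]

/-- The kernel law is a probability measure. [folklore] -/
theorem isProbabilityMeasure_kernelMeasure (ha : 0 < a) (hκ : 0 < κ) :
    IsProbabilityMeasure (kernelMeasure a κ) := by
  refine ⟨?_⟩
  rw [kernelMeasure, Measure.smul_apply, withDensity_apply _ MeasurableSet.univ,
    Measure.restrict_univ, smul_eq_mul,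
    ENNReal.inv_mul_cancel (lintegral_kernel_ne_zero a κ) (lintegral_kernel_ne_top ha hκ)]

/-- The normalising constant as a real number. [folklore] -/
theorem lintegral_kernel_eq (ha : 0 < a) (hκ : 0 < κ) :
    (∫⁻ u, ENNReal.ofReal (polyaKernel 0 a (κ * u))) =
      ENNReal.ofReal (∫ u, polyaKernel 0 a (κ * u)) :=
  (ofReal_integral_eq_lintegral_ofReal (integrable_kernel ha hκ)
    (Eventually.of_forall fun _ => polyaKernel_nonneg 0 a _)).symm

/-- Integrals against the kernel law: `∫ f dμ = (∫ k)⁻¹ • ∫ k • f`. [folklore] -/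
theorem integral_kernelMeasure (ha : 0 < a) (hκ : 0 < κ) {E : Type*} [NormedAddCommGroup E]
    [NormedSpace ℝ E] (f : ℝ → E) :
    ∫ u, f u ∂(kernelMeasure a κ) =
      (∫ u, polyaKernel 0 a (κ * u))⁻¹ • ∫ u, polyaKernel 0 a (κ * u) • f u := by
  rw [kernelMeasure, integral_smul_measure, integral_withDensity_eq_integral_toReal_smul
    (continuous_kernel a κ).measurable.ennreal_ofReal
    (Eventually.of_forall fun _ => ENNReal.ofReal_lt_top), lintegral_kernel_eq ha hκ,
    ENNReal.toReal_inv, ENNReal.toReal_ofReal (integral_nonneg fun u => polyaKernel_nonneg 0 a _)]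
  congr 1
  refine integral_congr_ae (Eventually.of_forall fun u => ?_)
  simp only [ENNReal.toReal_ofReal (polyaKernel_nonneg 0 a _)]

/-- `∫ e^{−a cosh(κu)} du > 0`. [folklore] -/
theorem integral_kernel_pos (ha : 0 < a) (hκ : 0 < κ) : 0 < ∫ u, polyaKernel 0 a (κ * u) :=
  integral_pos_of_integrable_nonneg_nonzero (x := (0 : ℝ)) (continuous_kernel a κ)
    (integrable_kernel ha hκ) (fun _ => polyaKernel_nonneg 0 a _) (polyaKernel_pos 0 a _).ne'

/-- **The characteristic function of the kernel law** is `G₀(a, y/κ)/G₀(a, 0) = S_{a,y/κ}(0)/2`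
(substitution `t = κu` in both integrals). [folklore] -/
theorem charFun_kernelMeasure (ha : 0 < a) (hκ : 0 < κ) (y : ℝ) :
    charFun (kernelMeasure a κ) y = solS a (y / κ) 0 / 2 := by
  rw [charFun_apply_real, integral_kernelMeasure ha hκ]
  have hκ' : (κ : ℂ) ≠ 0 := Complex.ofReal_ne_zero.2 hκ.ne'
  -- the two substitutions `t = κ u`
  have hsub1 : ∫ u : ℝ, polyaKernel 0 a (κ * u) • Complex.exp (y * u * I) =
      κ⁻¹ • polyaG 0 a ((y / κ : ℝ) : ℂ) := by
    have h := MeasureTheory.Measure.integral_comp_mul_left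
      (fun t : ℝ => (polyaKernel 0 a t : ℂ) * Complex.exp (I * ((y / κ : ℝ) : ℂ) * t)) κ
    rw [abs_of_pos (inv_pos.2 hκ)] at h
    rw [polyaG_eq, ← h]
    refine integral_congr_ae (Eventually.of_forall fun u => ?_)
    simp only [Complex.real_smul]
    congr 1
    push_cast
    field_simp
  have hsub2 : ∫ u : ℝ, polyaKernel 0 a (κ * u) = κ⁻¹ * ∫ t : ℝ, polyaKernel 0 a t := by
    have h := MeasureTheory.Measure.integral_comp_mul_left (fun t : ℝ => polyaKernel 0 a t) κ
    rwa [abs_of_pos (inv_pos.2 hκ), smul_eq_mul] at h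
  have hG0 : polyaG 0 a 0 = ((∫ t : ℝ, polyaKernel 0 a t : ℝ) : ℂ) := by
    rw [polyaG_eq, ← integral_complex_ofReal]
    exact integral_congr_ae (Eventually.of_forall fun t => by simp)
  have hP : 0 < ∫ t : ℝ, polyaKernel 0 a t := by
    simpa using integral_kernel_pos ha one_pos
  have hP' : ((∫ t : ℝ, polyaKernel 0 a t : ℝ) : ℂ) ≠ 0 := Complex.ofReal_ne_zero.2 hP.ne'
  rw [hsub1, hsub2, solS, Real.exp_zero, mul_one, hG0, Complex.real_smul, Complex.real_smul]
  push_cast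
  field_simp

end Kernel

/-! ## Composition -/

/-- **`C⁺`: the law `∝ e^{−a cosh(κu)} du` is an Ising limit law** (`a, κ > 0`), by the witness
chains of `LeeYangTelegraph` (weights `η_k/κ`): weak convergence by Lévy's continuity theorem from
`stub_transfer` + `stub_euler` (fed by `stub_rate`, `stub_solution`, `stub_localError`) and
`charFun_kernelMeasure`; moments by `stub_moments` (fed by `stub_transfer`, `stub_cone`). -/
theorem polyaKernelIsingLimit {a κ : ℝ} (ha : 0 < a) (hκ : 0 < κ) (ν : ProbabilityMeasure ℝ)
    (hν : (ν : Measure ℝ) = kernelMeasure a κ) : IsIsingLimitLaw ν := by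
  obtain ⟨hre, hq1, hanti, hrd⟩ := stub_rate a ha
  have hqa : ∀ v : ℝ, a ≤ v → besselRatio v ≤ besselRatio a := fun v hv =>
    hanti (Set.mem_Ioi.2 ha) (Set.mem_Ioi.2 (ha.trans_le hv)) hv
  have hr1 : ∀ t : ℝ, a * Real.exp t ≤ flipRate a t := fun t => by
    have hv : 0 < a * Real.exp t := mul_pos ha (Real.exp_pos t)
    unfold flipRate
    simpa using mul_le_mul_of_nonneg_left (hq1 _ hv) hv.le
  have hr2 : ∀ t : ℝ, 0 ≤ t → flipRate a t ≤ besselRatio a * (a * Real.exp t) := fun t ht => by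
    have hv : 0 < a * Real.exp t := mul_pos ha (Real.exp_pos t)
    have hav : a ≤ a * Real.exp t := by
      simpa using mul_le_mul_of_nonneg_left (Real.one_le_exp ht) ha.le
    unfold flipRate
    rw [mul_comm (besselRatio a)]
    exact mul_le_mul_of_nonneg_left (hqa _ hav) hv.le
  have hrpos : ∀ t : ℝ, 0 < flipRate a t := fun t => (mul_pos ha (Real.exp_pos t)).trans_le (hr1 t)
  -- the bond parameters lie in `(0, 1)`, so the couplings are `≥ 0` with the right `tanh`
  have hc0 : ∀ k m, 0 < bondTanh a k m := fun k m => Real.exp_pos _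
  have hc1 : ∀ k m, bondTanh a k m < 1 := fun k m => by
    unfold bondTanh
    rw [Real.exp_lt_one_iff]
    have := mul_pos (mul_pos two_pos ((mesh_pos' k).2.2)) (hrpos (siteTime k (m + 1)))
    linarith
  have htanh : ∀ k m, Real.tanh (chainK a k m) = bondTanh a k m := fun k m =>
    tanh_couplingOfTanh (hc0 k m).le (hc1 k m)
  refine ⟨fun k => nBonds k + 1, fun k => chainJ (nBonds k + 1) (chainK a k), fun k _ => mesh k / κ,
    fun k i j => chainJ_nonneg (fun m => couplingOfTanh_nonneg (hc0 k m).le (hc1 k m).le) i j,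
    fun k _ => (div_pos ((mesh_pos' k).2.2) hκ).le, ?_, ?_⟩
  · -- weak convergence, by Lévy's continuity theorem
    rw [ProbabilityMeasure.tendsto_iff_tendsto_charFun]
    intro y
    have hchain : ∀ k, charFun (isingMagnetizationLaw (nBonds k + 1)
        (chainJ (nBonds k + 1) (chainK a k)) (fun _ => mesh k / κ) : Measure ℝ) y =
        (sdIter (I * (y / κ : ℝ)) (fun _ => mesh k) (bondTanh a k) (nBonds k)).1 / 2 := by
      intro k
      rw [charFun_apply_real]
      have h1 := stub_transfer (nBonds k) (chainK a k) (fun _ => mesh k / κ) (I * y)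
      have h2 : ∫ u, Complex.exp (y * u * I) ∂(isingMagnetizationLaw (nBonds k + 1)
          (chainJ (nBonds k + 1) (chainK a k)) (fun _ => mesh k / κ) : Measure ℝ) =
          ∫ u, Complex.exp (I * y * u) ∂(isingMagnetizationLaw (nBonds k + 1)
          (chainJ (nBonds k + 1) (chainK a k)) (fun _ => mesh k / κ) : Measure ℝ) :=
        integral_congr_ae (Eventually.of_forall fun u => by ring_nf)
      rw [h2, h1]
      have h3 : sdIter (I * y) (fun _ => mesh k / κ) (fun m => Real.tanh (chainK a k m)) (nBonds k) =
          sdIter (I * (y / κ : ℝ)) (fun _ => mesh k) (bondTanh a k) (nBonds k) := by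
        rw [show (fun m => Real.tanh (chainK a k m)) = bondTanh a k from funext (htanh k)]
        refine sdIter_congr _ (fun m => ?_) _
        push_cast
        field_simp
      rw [h3]
    have hlim : Tendsto (fun k => (sdIter (I * (y / κ : ℝ)) (fun _ => mesh k) (bondTanh a k)
        (nBonds k)).1) atTop (𝓝 (solS a (y / κ) 0)) := by
      obtain ⟨hS, hD, hSb, hDb, hS2⟩ := stub_solution a ha (y / κ) hre hq1 hqa
      obtain ⟨L, hL⟩ := stub_localError a (besselRatio a) (y / κ) ha (hq1 a ha) (solS a (y / κ))
        (solD a (y / κ)) (flipRate a) hS hD hrd hSb hDb hr1 hr2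
      exact stub_euler a (y / κ) ha (solS a (y / κ)) (solD a (y / κ)) L hL hS2 hDb hr1
    have htarget : charFun (ν : Measure ℝ) y = solS a (y / κ) 0 / 2 := by
      rw [hν]; exact charFun_kernelMeasure ha hκ y
    rw [htarget]
    simp_rw [hchain]
    exact hlim.div_const 2
  · -- uniform Gaussian-exponential moments
    intro b
    exact stub_moments a κ ha hκ stub_transfer stub_cone hr1 b

/-- **The crux, by name.** The law `∝ cosh(9u/2) e^{−2π cosh 2u} du` is the `cosh((9/2)u)`-tilt of
the kernel law with `a = 2π`, `κ = 2` (`e^{−2π cosh 2u} = polyaKernel 0 (2π) (2u)`), so it is an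
Ising limit law by `polyaKernelIsingLimit` and `stub_coshTilt`. -/
theorem LeeyangPolyaKernelIsingLimit_of :
    Summit.RiemannHypothesis.RiemannHypothesis.Theses.LeeYang.LeeyangPolyaKernelIsingLimit := by
  intro ν hν
  have ha : (0 : ℝ) < 2 * Real.pi := by positivity
  have hκ : (0 : ℝ) < 2 := two_pos
  haveI hprob : IsProbabilityMeasure (kernelMeasure (2 * Real.pi) 2) :=
    isProbabilityMeasure_kernelMeasure ha hκ
  set μ : ProbabilityMeasure ℝ := ⟨kernelMeasure (2 * Real.pi) 2, hprob⟩ with hμdef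
  have hμ : IsIsingLimitLaw μ := polyaKernelIsingLimit ha hκ μ rfl
  refine stub_coshTilt (9 / 2) (by norm_num) μ ν hμ ?_
  -- measure algebra: `ν = (∫⁻ cosh dμ)⁻¹ • μ.withDensity cosh`
  set f : ℝ → ENNReal := fun u => ENNReal.ofReal (polyaKernel 0 (2 * Real.pi) (2 * u)) with hf
  set g : ℝ → ENNReal := fun u => ENNReal.ofReal (Real.cosh (9 / 2 * u)) with hg
  set Z : ENNReal := ∫⁻ u, f u with hZ
  have hfm : Measurable f := (continuous_kernel (2 * Real.pi) 2).measurable.ennreal_ofReal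
  have hgm : Measurable g := by
    refine Measurable.ennreal_ofReal ?_
    exact (Real.continuous_cosh.comp (continuous_const.mul continuous_id)).measurable
  have hZ0 : Z ≠ 0 := lintegral_kernel_ne_zero (2 * Real.pi) 2
  have hZtop : Z ≠ ⊤ := lintegral_kernel_ne_top ha hκ
  have hμeq : (μ : Measure ℝ) = Z⁻¹ • volume.withDensity f := rfl
  have hfg : f * g = fun u => ENNReal.ofReal
      (Real.cosh (9 * u / 2) * Real.exp (-(2 * Real.pi * Real.cosh (2 * u)))) := by
    funext u
    simp only [Pi.mul_apply, hf, hg, polyaKernel_zero]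
    rw [← ENNReal.ofReal_mul (Real.exp_pos _).le, mul_comm,
      show (9 / 2 * u : ℝ) = 9 * u / 2 by ring]
  have h1 : (μ : Measure ℝ).withDensity g = Z⁻¹ • volume.withDensity (f * g) := by
    rw [hμeq, withDensity_smul_measure, withDensity_mul _ hfm hgm]
  have h2 : (∫⁻ u, g u ∂(μ : Measure ℝ)) = Z⁻¹ * ∫⁻ u, (f * g) u := by
    rw [hμeq, lintegral_smul_measure, lintegral_withDensity_eq_lintegral_mul _ hfm hgm, smul_eq_mul]
  change (ν : Measure ℝ) = (∫⁻ u, g u ∂(μ : Measure ℝ))⁻¹ • (μ : Measure ℝ).withDensity g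
  rw [h1, h2, hν, smul_smul, hfg]
  congr 1
  beta_reduce
  rw [ENNReal.mul_inv (Or.inl (ENNReal.inv_ne_zero.2 hZtop)) (Or.inl (ENNReal.inv_ne_top.2 hZ0)),
    inv_inv, mul_right_comm, ENNReal.mul_inv_cancel hZ0 hZtop, one_mul]

end Summit.RiemannHypothesis.RiemannHypothesis.Theorems.LeeYangTelegraph

namespace Summit.RiemannHypothesis.RiemannHypothesis.Theorems

/-- **Crux `LeeYang.LeeyangPolyaKernelIsingLimit` (stmt-RiemannHypothesis-0453), closing theorem.**
The probability law `∝ cosh(9u/2) e^{−2π cosh 2u} du` (Pólya's kernel) is an Ising limit law: it is the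
`cosh((9/2)u)`-tilt (one ghost spin) of the law `∝ e^{−2π cosh 2u}du`, which is the weak limit, with
uniformly bounded Gaussian-exponential moments, of the magnetization laws of the open ferromagnetic
Ising chains of `LeeYangTelegraph` (the Euler scheme of the telegraph process with Bessel flip rate
`v K₁(v)/K₀(v)`, whose occupation law is Pólya's kernel law). -/
theorem leeyangPolyaKernelIsingLimit_proof :
    Summit.RiemannHypothesis.RiemannHypothesis.Theses.LeeYang.LeeyangPolyaKernelIsingLimit :=
  LeeYangTelegraph.LeeyangPolyaKernelIsingLimit_of

end Summit.RiemannHypothesis.RiemannHypothesis.Theorems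

end
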